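import Mathlib.NumberTheory.EulerProduct.DirichletLSeries
import Mathlib.NumberTheory.SumPrimeReciprocals
import Mathlib.Analysis.SpecialFunctions.Complex.LogBounds
import Mathlib.Analysis.SpecialFunctions.Pow.Deriv
import Mathlib.Analysis.Calculus.Deriv.Slope
import Mathlib.Analysis.Complex.RealDeriv
import HarnessLib

/-!
# Auxiliary lemmas for the stub `stub_ZE` of the crux skeleton `DefiniteXi.PeterssonLowerBound` (stmt-ABC-10870), line Sketch

Elementary facts used to build the Goldfeld–Hoffstein–Lieman auxiliary function
`Z_E = ζ² (L_f·corr)³ L₄` on the real axis right of `1`: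

* prime-power Dirichlet series `Σ_p Σ_k b(p,k) p^{-(k+1)s}` with REAL coefficients at real points
  (`logEulerTerm_ofReal`, `norm_logEulerTerm`, `logEuler_real_summable`): conversion of the
  complex series and of its absolute summability to real double series;
* the log-Euler series of `ζ` at real `x > 1` in this format (`riemannZeta_ofReal_eq_exp_logEuler`,
  coefficients `1/(k+1)`), from Mathlib's `riemannZeta_eulerProduct_exp_log` and the Taylor series
  of `-log(1 - z)`;
* linear combinations and antitonicity of real double series with non-negative coefficients
  (`logEuler_real_comb`, `logEuler_real_antitone`);
* the correction factor `corr(s) = ∏_{p ∣ N}(1 + p^{-s})`: entire, `|corr(s)| ≤ N` for `Re s ≥ 0`;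
* the sign of `Re Z'/Z(σ)` for a holomorphic `Z` that is real, positive and antitone on `(1, ∞)`.
-/

noncomputable section

open scoped Real Topology
open Set Filter Metric Complex

-- the summit-side namespace `Summit.ABC.ABC.Theorems` (summit = problem = `ABC`) is fixed by the tree layout
set_option linter.dupNamespace false

namespace Summit.ABC.ABC.Theorems

/-! ### Terms `b · p^{-(k+1)s}` with real `b` -/

/-- At a real point `x`, the term `b · p^{-(k+1)x}` with real `b` is the real number
`b · p^{-(k+1)x}`. [folklore] -/
theorem logEulerTerm_ofReal (b x : ℝ) (p : Nat.Primes) (k : ℕ) :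
    ((b : ℝ) : ℂ) * (p : ℂ) ^ (-((k + 1 : ℕ) : ℂ) * (x : ℂ)) =
      ((b * (p : ℝ) ^ (-((k + 1 : ℕ) : ℝ) * x) : ℝ) : ℂ) := by
  rw [Complex.ofReal_mul, Complex.ofReal_cpow (Nat.cast_nonneg _), Complex.ofReal_natCast]
  congr 2
  push_cast
  ring

/-- `‖b · p^{-(k+1)s}‖ = |b| · p^{-(k+1) Re s}` for real `b`. [folklore] -/
theorem norm_logEulerTerm (b : ℝ) (p : Nat.Primes) (k : ℕ) (s : ℂ) :
    ‖((b : ℝ) : ℂ) * (p : ℂ) ^ (-((k + 1 : ℕ) : ℂ) * s)‖ =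
      |b| * (p : ℝ) ^ (-((k + 1 : ℕ) : ℝ) * s.re) := by
  rw [norm_mul, Complex.norm_real, Real.norm_eq_abs, Complex.norm_natCast_cpow_of_pos p.prop.pos]
  congr 2
  simp [Complex.mul_re]

/-- At a real point the complex and the real terms have the same norm. [folklore] -/
theorem norm_logEulerTerm_ofReal (b x : ℝ) (p : Nat.Primes) (k : ℕ) :
    ‖((b : ℝ) : ℂ) * (p : ℂ) ^ (-((k + 1 : ℕ) : ℂ) * (x : ℂ))‖ =
      ‖b * (p : ℝ) ^ (-((k + 1 : ℕ) : ℝ) * x)‖ := by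
  rw [logEulerTerm_ofReal, Complex.norm_real]

/-- **Real points: the complex double series is the real double series**, and absolute
summability of the complex terms gives summability of the real inner series and of the real
outer series of inner sums. [folklore] -/
theorem logEuler_real_summable {b : Nat.Primes → ℕ → ℝ} {x : ℝ}
    (h1 : ∀ p : Nat.Primes, Summable fun k : ℕ ↦
      ‖((b p k : ℝ) : ℂ) * (p : ℂ) ^ (-((k + 1 : ℕ) : ℂ) * (x : ℂ))‖)
    (h2 : Summable fun p : Nat.Primes ↦ ∑' k : ℕ,
      ‖((b p k : ℝ) : ℂ) * (p : ℂ) ^ (-((k + 1 : ℕ) : ℂ) * (x : ℂ))‖) :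
    (∀ p : Nat.Primes, Summable fun k : ℕ ↦ b p k * (p : ℝ) ^ (-((k + 1 : ℕ) : ℝ) * x)) ∧
    (Summable fun p : Nat.Primes ↦ ∑' k : ℕ, b p k * (p : ℝ) ^ (-((k + 1 : ℕ) : ℝ) * x)) ∧
    ∑' p : Nat.Primes, ∑' k : ℕ, ((b p k : ℝ) : ℂ) * (p : ℂ) ^ (-((k + 1 : ℕ) : ℂ) * (x : ℂ)) =
      ((∑' p : Nat.Primes, ∑' k : ℕ, b p k * (p : ℝ) ^ (-((k + 1 : ℕ) : ℝ) * x) : ℝ) : ℂ) := by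
  simp only [norm_logEulerTerm_ofReal] at h1 h2
  refine ⟨fun p ↦ (h1 p).of_norm, h2.of_norm_bounded fun p ↦ norm_tsum_le_tsum_norm (h1 p), ?_⟩
  rw [Complex.ofReal_tsum]
  refine tsum_congr fun p ↦ ?_
  rw [Complex.ofReal_tsum]
  exact tsum_congr fun k ↦ logEulerTerm_ofReal _ _ _ _

/-! ### The log-Euler series of `ζ` at real points -/

/-- For a prime `p` and real `x ≥ 1`: `0 < p^{-x} ≤ 1/2`. [folklore] -/
theorem prime_rpow_neg_pos_le_half (p : Nat.Primes) {x : ℝ} (hx : 1 ≤ x) :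
    0 < (p : ℝ) ^ (-x) ∧ (p : ℝ) ^ (-x) ≤ 1 / 2 := by
  have hp : (2 : ℝ) ≤ p := by exact_mod_cast p.prop.two_le
  have hp0 : (0 : ℝ) < p := by linarith
  refine ⟨Real.rpow_pos_of_pos hp0 _, ?_⟩
  calc (p : ℝ) ^ (-x) ≤ (2 : ℝ) ^ (-x) := Real.rpow_le_rpow_of_nonpos (by norm_num) hp (by linarith)
    _ ≤ (2 : ℝ) ^ (-1 : ℝ) := Real.rpow_le_rpow_of_exponent_le (by norm_num) (by linarith)
    _ = 1 / 2 := by rw [Real.rpow_neg_one]; norm_num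

/-- For `0 ≤ r ≤ 1/2`: `Σ_k r^{k+1}/(k+1)` converges and is at most `Σ_k r^{k+1} = r/(1-r) ≤ 2r`.
[folklore] -/
theorem summable_geometric_div_succ {r : ℝ} (h0 : 0 ≤ r) (h2 : r ≤ 1 / 2) :
    (Summable fun k : ℕ ↦ r ^ (k + 1) / ((k : ℝ) + 1)) ∧
      ∑' k : ℕ, r ^ (k + 1) / ((k : ℝ) + 1) ≤ 2 * r := by
  have h1 : r < 1 := by linarith
  have hg : HasSum (fun k : ℕ ↦ r ^ (k + 1)) (r * (1 - r)⁻¹) := by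
    simpa only [pow_succ'] using (hasSum_geometric_of_lt_one h0 h1).mul_left r
  have hle : ∀ k : ℕ, r ^ (k + 1) / ((k : ℝ) + 1) ≤ r ^ (k + 1) := fun k ↦
    div_le_self (pow_nonneg h0 _) (by linarith [(Nat.cast_nonneg k : (0 : ℝ) ≤ k)])
  have hnn : ∀ k : ℕ, 0 ≤ r ^ (k + 1) / ((k : ℝ) + 1) := fun k ↦ by positivity
  have hs : Summable fun k : ℕ ↦ r ^ (k + 1) / ((k : ℝ) + 1) :=
    hg.summable.of_nonneg_of_le hnn hle
  refine ⟨hs, ?_⟩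
  calc ∑' k : ℕ, r ^ (k + 1) / ((k : ℝ) + 1)
        ≤ ∑' k : ℕ, r ^ (k + 1) := hs.tsum_le_tsum hle hg.summable
    _ = r * (1 - r)⁻¹ := hg.tsum_eq
    _ ≤ 2 * r := by
        rw [← div_eq_mul_inv, div_le_iff₀ (by linarith)]
        nlinarith

/-- `‖(1/(k+1)) p^{-(k+1)x}‖ = (p^{-x})^{k+1}/(k+1)` at a real point `x`. [folklore] -/
theorem norm_zetaLogTerm (p : Nat.Primes) (k : ℕ) (x : ℝ) :
    ‖(((1 / ((k : ℝ) + 1) : ℝ)) : ℂ) * (p : ℂ) ^ (-((k + 1 : ℕ) : ℂ) * (x : ℂ))‖ =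
      ((p : ℝ) ^ (-x)) ^ (k + 1) / ((k : ℝ) + 1) := by
  rw [norm_logEulerTerm, Complex.ofReal_re, abs_of_nonneg (by positivity),
    show -((k + 1 : ℕ) : ℝ) * x = (-x) * ((k + 1 : ℕ) : ℝ) by ring,
    Real.rpow_mul_natCast (Nat.cast_nonneg _)]
  ring

/-- The Taylor series of the logarithm of an Euler factor of `ζ` at a real point `x > 0`:
`-log(1 - p^{-x}) = Σ_{k ≥ 0} p^{-(k+1)x}/(k+1)`. [folklore] -/
theorem neg_log_one_sub_prime_cpow_eq_tsum (p : Nat.Primes) {x : ℝ} (hx : 0 < x) :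
    -Complex.log (1 - (p : ℂ) ^ (-(x : ℂ))) =
      ∑' k : ℕ, (((1 / ((k : ℝ) + 1) : ℝ)) : ℂ) * (p : ℂ) ^ (-((k + 1 : ℕ) : ℂ) * (x : ℂ)) := by
  have hp1 : (1 : ℝ) < p := by exact_mod_cast p.prop.one_lt
  have hzn : ‖(p : ℂ) ^ (-(x : ℂ))‖ < 1 := by
    rw [Complex.norm_natCast_cpow_of_pos p.prop.pos, Complex.neg_re, Complex.ofReal_re]
    exact Real.rpow_lt_one_of_one_lt_of_neg hp1 (by linarith)
  have h := (hasSum_nat_add_iff' 1).mpr (Complex.hasSum_taylorSeries_neg_log hzn)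
  simp only [Finset.range_one, Finset.sum_singleton, pow_zero, Nat.cast_zero, div_zero,
    sub_zero] at h
  rw [← h.tsum_eq]
  refine tsum_congr fun k ↦ ?_
  rw [← Complex.cpow_nat_mul, show ((k + 1 : ℕ) : ℂ) * -(x : ℂ) = -((k + 1 : ℕ) : ℂ) * (x : ℂ) by ring]
  push_cast
  ring

/-- **The log-Euler series of `ζ` at a real point `x > 1`**, in the prime-power format with
coefficients `1/(k+1)`: `ζ(x) = exp(Σ_p Σ_k (1/(k+1)) p^{-(k+1)x})`, the terms being absolutely
summable (inner series for each `p`, and the outer series of the inner sums of norms).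
(Mathlib's `riemannZeta_eulerProduct_exp_log` and the Taylor series of `-log(1 - z)`; the
majorant is the geometric series, `p^{-x} ≤ 1/2`.) [folklore] -/
theorem riemannZeta_ofReal_eq_exp_logEuler {x : ℝ} (hx : 1 < x) :
    (∀ p : Nat.Primes, Summable fun k : ℕ ↦
      ‖(((1 / ((k : ℝ) + 1) : ℝ)) : ℂ) * (p : ℂ) ^ (-((k + 1 : ℕ) : ℂ) * (x : ℂ))‖) ∧
    (Summable fun p : Nat.Primes ↦ ∑' k : ℕ,
      ‖(((1 / ((k : ℝ) + 1) : ℝ)) : ℂ) * (p : ℂ) ^ (-((k + 1 : ℕ) : ℂ) * (x : ℂ))‖) ∧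
    riemannZeta x = Complex.exp (∑' p : Nat.Primes, ∑' k : ℕ,
      (((1 / ((k : ℝ) + 1) : ℝ)) : ℂ) * (p : ℂ) ^ (-((k + 1 : ℕ) : ℂ) * (x : ℂ))) := by
  have hgeo := fun p : Nat.Primes ↦ summable_geometric_div_succ
    (prime_rpow_neg_pos_le_half p hx.le).1.le (prime_rpow_neg_pos_le_half p hx.le).2
  simp only [norm_zetaLogTerm]
  refine ⟨fun p ↦ (hgeo p).1, ?_, ?_⟩
  · exact ((Nat.Primes.summable_rpow.mpr (by linarith : -x < -1)).mul_left 2).of_nonneg_of_le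
      (fun p ↦ tsum_nonneg fun k ↦ by positivity) fun p ↦ (hgeo p).2
  · rw [← riemannZeta_eulerProduct_exp_log (by simpa using hx : 1 < (x : ℂ).re)]
    congr 1
    exact tsum_congr fun p ↦ neg_log_one_sub_prime_cpow_eq_tsum p (by linarith)

/-! ### Real double series: linear combinations and antitonicity -/

/-- The linear combination `2Σ₀ + 3Σ₂ + Σ₄` of three real double series, each with summable
inner series and summable outer series of inner sums. [folklore] -/
theorem tsum_tsum_comb {ι κ : Type*} {F₀ F₂ F₄ : ι → κ → ℝ}
    (h₀ : ∀ i, Summable (F₀ i)) (h₀' : Summable fun i ↦ ∑' k, F₀ i k)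
    (h₂ : ∀ i, Summable (F₂ i)) (h₂' : Summable fun i ↦ ∑' k, F₂ i k)
    (h₄ : ∀ i, Summable (F₄ i)) (h₄' : Summable fun i ↦ ∑' k, F₄ i k) :
    (∀ i, Summable fun k ↦ 2 * F₀ i k + 3 * F₂ i k + F₄ i k) ∧
    (Summable fun i ↦ ∑' k, (2 * F₀ i k + 3 * F₂ i k + F₄ i k)) ∧
    ∑' i, ∑' k, (2 * F₀ i k + 3 * F₂ i k + F₄ i k) =
      2 * ∑' i, ∑' k, F₀ i k + 3 * ∑' i, ∑' k, F₂ i k + ∑' i, ∑' k, F₄ i k := by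
  have hin : ∀ i, Summable fun k ↦ 2 * F₀ i k + 3 * F₂ i k + F₄ i k :=
    fun i ↦ (((h₀ i).mul_left 2).add ((h₂ i).mul_left 3)).add (h₄ i)
  have hin_eq : ∀ i, ∑' k, (2 * F₀ i k + 3 * F₂ i k + F₄ i k) =
      2 * ∑' k, F₀ i k + 3 * ∑' k, F₂ i k + ∑' k, F₄ i k := fun i ↦ by
    rw [(((h₀ i).mul_left 2).add ((h₂ i).mul_left 3)).tsum_add (h₄ i),
      ((h₀ i).mul_left 2).tsum_add ((h₂ i).mul_left 3), tsum_mul_left, tsum_mul_left]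
  refine ⟨hin, ?_, ?_⟩
  · simp only [hin_eq]
    exact ((h₀'.mul_left 2).add (h₂'.mul_left 3)).add h₄'
  · simp only [hin_eq]
    rw [((h₀'.mul_left 2).add (h₂'.mul_left 3)).tsum_add h₄',
      (h₀'.mul_left 2).tsum_add (h₂'.mul_left 3), tsum_mul_left, tsum_mul_left]

/-- **Antitonicity** of a real prime-power series with non-negative coefficients:
`x ≤ y ⟹ Σ_p Σ_k c(p,k) p^{-(k+1)y} ≤ Σ_p Σ_k c(p,k) p^{-(k+1)x}` (termwise, `p ≥ 2`), given
summability at `x` (summability at `y` follows by comparison). [folklore] -/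
theorem logEuler_real_antitone {c : Nat.Primes → ℕ → ℝ} (hc : ∀ p k, 0 ≤ c p k) {x y : ℝ}
    (hxy : x ≤ y)
    (h1 : ∀ p : Nat.Primes, Summable fun k : ℕ ↦ c p k * (p : ℝ) ^ (-((k + 1 : ℕ) : ℝ) * x))
    (h2 : Summable fun p : Nat.Primes ↦ ∑' k : ℕ, c p k * (p : ℝ) ^ (-((k + 1 : ℕ) : ℝ) * x)) :
    ∑' p : Nat.Primes, ∑' k : ℕ, c p k * (p : ℝ) ^ (-((k + 1 : ℕ) : ℝ) * y) ≤
      ∑' p : Nat.Primes, ∑' k : ℕ, c p k * (p : ℝ) ^ (-((k + 1 : ℕ) : ℝ) * x) := by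
  have hnn : ∀ (z : ℝ) (p : Nat.Primes) (k : ℕ),
      0 ≤ c p k * (p : ℝ) ^ (-((k + 1 : ℕ) : ℝ) * z) :=
    fun z p k ↦ mul_nonneg (hc p k) (Real.rpow_nonneg (Nat.cast_nonneg _) _)
  have hle : ∀ (p : Nat.Primes) (k : ℕ), c p k * (p : ℝ) ^ (-((k + 1 : ℕ) : ℝ) * y) ≤
      c p k * (p : ℝ) ^ (-((k + 1 : ℕ) : ℝ) * x) := fun p k ↦ by
    refine mul_le_mul_of_nonneg_left (Real.rpow_le_rpow_of_exponent_le ?_ ?_) (hc p k)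
    · exact_mod_cast p.prop.one_lt.le
    · have : (0 : ℝ) ≤ ((k + 1 : ℕ) : ℝ) := Nat.cast_nonneg _
      nlinarith
  have h1y : ∀ p : Nat.Primes, Summable fun k : ℕ ↦ c p k * (p : ℝ) ^ (-((k + 1 : ℕ) : ℝ) * y) :=
    fun p ↦ (h1 p).of_nonneg_of_le (hnn y p) (hle p)
  have hin : ∀ p : Nat.Primes, ∑' k : ℕ, c p k * (p : ℝ) ^ (-((k + 1 : ℕ) : ℝ) * y) ≤
      ∑' k : ℕ, c p k * (p : ℝ) ^ (-((k + 1 : ℕ) : ℝ) * x) :=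
    fun p ↦ (h1y p).tsum_le_tsum (hle p) (h1 p)
  have h2y : Summable fun p : Nat.Primes ↦ ∑' k : ℕ, c p k * (p : ℝ) ^ (-((k + 1 : ℕ) : ℝ) * y) :=
    h2.of_nonneg_of_le (fun p ↦ tsum_nonneg (hnn y p)) hin
  exact h2y.tsum_le_tsum hin h2

/-! ### The correction factor `∏_{p ∣ N}(1 + p^{-s})` -/

/-- `s ↦ ∏_{p ∣ N}(1 + p^{-s})` is entire. [folklore] -/
theorem differentiable_corr (N : ℕ) :
    Differentiable ℂ fun s : ℂ ↦ ∏ p ∈ N.primeFactors, (1 + (p : ℂ) ^ (-s)) := by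
  refine Differentiable.fun_finsetProd fun p hp ↦ ?_
  have hp : (p : ℂ) ≠ 0 := by exact_mod_cast (Nat.prime_of_mem_primeFactors hp).ne_zero
  intro s
  exact (differentiableAt_id.neg.const_cpow (Or.inl hp)).const_add 1

/-- **`|∏_{p ∣ N}(1 + p^{-s})| ≤ N` for `Re s ≥ 0`** (each factor has modulus `≤ 2`, and
`2^{ω(N)} ≤ ∏_{p ∣ N} p ≤ N`; cf. `Literature.NumberTheory.Sieve.GPY.two_pow_card_primeFactors_le`).
[folklore] -/
theorem norm_corr_le {N : ℕ} (hN : N ≠ 0) {s : ℂ} (hs : 0 ≤ s.re) :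
    ‖∏ p ∈ N.primeFactors, (1 + (p : ℂ) ^ (-s))‖ ≤ N := by
  have h2 : ∀ p ∈ N.primeFactors, ‖1 + (p : ℂ) ^ (-s)‖ ≤ 2 := fun p hp ↦ by
    have hp := Nat.prime_of_mem_primeFactors hp
    calc ‖1 + (p : ℂ) ^ (-s)‖ ≤ ‖(1 : ℂ)‖ + ‖(p : ℂ) ^ (-s)‖ := norm_add_le _ _
      _ ≤ 1 + 1 := by
          rw [norm_one, Complex.norm_natCast_cpow_of_pos hp.pos, Complex.neg_re]
          gcongr
          exact Real.rpow_le_one_of_one_le_of_nonpos (by exact_mod_cast hp.one_lt.le) (by linarith)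
      _ = 2 := by norm_num
  calc ‖∏ p ∈ N.primeFactors, (1 + (p : ℂ) ^ (-s))‖
        = ∏ p ∈ N.primeFactors, ‖1 + (p : ℂ) ^ (-s)‖ := norm_prod _ _
    _ ≤ ∏ _p ∈ N.primeFactors, (2 : ℝ) := Finset.prod_le_prod (fun _ _ ↦ norm_nonneg _) h2
    _ = ((2 ^ N.primeFactors.card : ℕ) : ℝ) := by rw [Finset.prod_const]; push_cast; rfl
    _ ≤ ((∏ p ∈ N.primeFactors, p : ℕ) : ℝ) := by
        exact_mod_cast Finset.pow_card_le_prod _ _ 2 fun _ hp ↦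
          (Nat.prime_of_mem_primeFactors hp).two_le
    _ ≤ N := by
        exact_mod_cast Nat.le_of_dvd (Nat.pos_of_ne_zero hN) (Nat.prod_primeFactors_dvd N)

/-! ### The sign of `Re Z'/Z` on the real axis -/

/-- If `Z` is complex-differentiable at the real point `σ > 1` and coincides on `(1, ∞)` with a
real, positive-at-`σ`, antitone function `g`, then `Re (Z'(σ)/Z(σ)) ≤ 0`. [folklore] -/
theorem re_deriv_div_nonpos_of_antitoneOn {Z : ℂ → ℂ} {g : ℝ → ℝ} {σ : ℝ} (hσ : 1 < σ)
    (hZ : DifferentiableAt ℂ Z σ) (hg : AntitoneOn g (Ioi 1)) (hpos : 0 < g σ)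
    (heq : ∀ y : ℝ, 1 < y → Z y = (g y : ℂ)) :
    (deriv Z σ / Z σ).re ≤ 0 := by
  have h2 : HasDerivAt (fun y : ℝ ↦ (Z y).re) (deriv Z σ).re σ := hZ.hasDerivAt.real_of_complex
  have h3 : AntitoneOn (fun y : ℝ ↦ (Z y).re) (Ioi 1) := by
    intro a ha b hb hab
    simp only [heq a ha, heq b hb, Complex.ofReal_re]
    exact hg ha hb hab
  have h4 : AccPt σ (𝓟 (Ioi 1)) := by
    rw [accPt_principal_iff_nhdsWithin]
    have hle : (𝓝[>] σ) ≤ 𝓝[Ioi 1 \ {σ}] σ :=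
      nhdsWithin_mono _ fun y hy ↦ ⟨lt_trans hσ hy, ne_of_gt hy⟩
    exact (inferInstance : (𝓝[>] σ).NeBot).mono hle
  have h5 : (deriv Z σ).re ≤ 0 := h2.hasDerivWithinAt.nonpos_of_antitoneOn h4 h3
  rw [heq σ hσ, Complex.div_ofReal_re]
  exact div_nonpos_of_nonpos_of_nonneg h5 hpos.le

/-- If `Z(σ) = g(σ)` with `g(σ) ≥ 1` real then `|Z(σ)| ≥ 1`. [folklore] -/
theorem one_le_norm_of_eq_ofReal {Z : ℂ → ℂ} {g : ℝ → ℝ} {σ : ℝ} (h1 : 1 ≤ g σ)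
    (heq : Z σ = (g σ : ℂ)) : 1 ≤ ‖Z σ‖ := by
  rw [heq, Complex.norm_real, Real.norm_eq_abs]
  exact h1.trans (le_abs_self _)

/-! ### The real axis: `ζ² L_♭³ L₄ = exp(T)` with `T ≥ 0` antitone -/

/-- **The auxiliary function on the real axis.** Let `b₂, b₄` be real coefficient systems with
`2/(k+1) + 3 b₂(p,k) + b₄(p,k) ≥ 0`, and let `L_♭`, `L₄` satisfy, at every real `y > 1`,
`L_♭(y) = exp(Σ_p Σ_k b₂(p,k) p^{-(k+1)y})`, `L₄(y) = exp(Σ_p Σ_k b₄(p,k) p^{-(k+1)y})` with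
absolutely convergent series. Then there is a real function `T`, antitone and non-negative on
`(1, ∞)`, with `ζ(y)² L_♭(y)³ L₄(y) = exp(T(y))` for all real `y > 1` — namely
`T(y) = Σ_p Σ_k (2/(k+1) + 3b₂ + b₄) p^{-(k+1)y}`, using `ζ(y) = exp(Σ_p Σ_k p^{-(k+1)y}/(k+1))`.
[cite: HoffsteinLockhart1994, Appendix (Goldfeld–Hoffstein–Lieman)] -/
theorem exists_realAxis_exp {b₂ b₄ : Nat.Primes → ℕ → ℝ}
    (hc : ∀ (p : Nat.Primes) (k : ℕ), 0 ≤ 2 * (1 / ((k : ℝ) + 1)) + 3 * b₂ p k + b₄ p k)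
    {Lb L₄ : ℂ → ℂ}
    (h₂ : ∀ y : ℝ, 1 < y →
      (∀ p : Nat.Primes, Summable fun k : ℕ ↦
        ‖((b₂ p k : ℝ) : ℂ) * (p : ℂ) ^ (-((k + 1 : ℕ) : ℂ) * (y : ℂ))‖) ∧
      (Summable fun p : Nat.Primes ↦ ∑' k : ℕ,
        ‖((b₂ p k : ℝ) : ℂ) * (p : ℂ) ^ (-((k + 1 : ℕ) : ℂ) * (y : ℂ))‖) ∧
      Lb y = Complex.exp (∑' p : Nat.Primes, ∑' k : ℕ,
        ((b₂ p k : ℝ) : ℂ) * (p : ℂ) ^ (-((k + 1 : ℕ) : ℂ) * (y : ℂ))))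
    (h₄ : ∀ y : ℝ, 1 < y →
      (∀ p : Nat.Primes, Summable fun k : ℕ ↦
        ‖((b₄ p k : ℝ) : ℂ) * (p : ℂ) ^ (-((k + 1 : ℕ) : ℂ) * (y : ℂ))‖) ∧
      (Summable fun p : Nat.Primes ↦ ∑' k : ℕ,
        ‖((b₄ p k : ℝ) : ℂ) * (p : ℂ) ^ (-((k + 1 : ℕ) : ℂ) * (y : ℂ))‖) ∧
      L₄ y = Complex.exp (∑' p : Nat.Primes, ∑' k : ℕ,
        ((b₄ p k : ℝ) : ℂ) * (p : ℂ) ^ (-((k + 1 : ℕ) : ℂ) * (y : ℂ)))) :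
    ∃ T : ℝ → ℝ, AntitoneOn T (Ioi 1) ∧ (∀ y : ℝ, 1 < y → 0 ≤ T y) ∧
      ∀ y : ℝ, 1 < y → riemannZeta y ^ 2 * Lb y ^ 3 * L₄ y = ((Real.exp (T y) : ℝ) : ℂ) := by
  -- the combined coefficients
  set c : Nat.Primes → ℕ → ℝ := fun p k ↦ 2 * (1 / ((k : ℝ) + 1)) + 3 * b₂ p k + b₄ p k
    with hc_def
  have hc' : ∀ (p : Nat.Primes) (k : ℕ), 0 ≤ c p k := hc
  -- summability of the combined real series at every `y > 1`, and the value of `ζ² L_♭³ L₄`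
  have key : ∀ y : ℝ, 1 < y →
      (∀ p : Nat.Primes, Summable fun k : ℕ ↦ c p k * (p : ℝ) ^ (-((k + 1 : ℕ) : ℝ) * y)) ∧
      (Summable fun p : Nat.Primes ↦ ∑' k : ℕ, c p k * (p : ℝ) ^ (-((k + 1 : ℕ) : ℝ) * y)) ∧
      riemannZeta y ^ 2 * Lb y ^ 3 * L₄ y = Complex.exp
        ((∑' p : Nat.Primes, ∑' k : ℕ, c p k * (p : ℝ) ^ (-((k + 1 : ℕ) : ℝ) * y) : ℝ) : ℂ) := by
    intro y hy
    obtain ⟨hz1, hz2, hz3⟩ := riemannZeta_ofReal_eq_exp_logEuler hy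
    obtain ⟨h21, h22, h23⟩ := h₂ y hy
    obtain ⟨h41, h42, h43⟩ := h₄ y hy
    obtain ⟨hr01, hr02, hr03⟩ := logEuler_real_summable hz1 hz2
    obtain ⟨hr21, hr22, hr23⟩ := logEuler_real_summable h21 h22
    obtain ⟨hr41, hr42, hr43⟩ := logEuler_real_summable h41 h42
    obtain ⟨hs1, hs2, hs3⟩ := tsum_tsum_comb hr01 hr02 hr21 hr22 hr41 hr42
    have e : ∀ (p : Nat.Primes) (k : ℕ), c p k * (p : ℝ) ^ (-((k + 1 : ℕ) : ℝ) * y) =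
        2 * ((1 / ((k : ℝ) + 1)) * (p : ℝ) ^ (-((k + 1 : ℕ) : ℝ) * y)) +
        3 * (b₂ p k * (p : ℝ) ^ (-((k + 1 : ℕ) : ℝ) * y)) +
        b₄ p k * (p : ℝ) ^ (-((k + 1 : ℕ) : ℝ) * y) := by
      intro p k; simp only [hc_def]; ring
    simp only [e]
    refine ⟨hs1, hs2, ?_⟩
    rw [hs3, hz3, h23, h43, hr03, hr23, hr43, ← Complex.exp_nat_mul, ← Complex.exp_nat_mul,
      ← Complex.exp_add, ← Complex.exp_add]
    push_cast
    ring_nf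
  refine ⟨fun y ↦ ∑' p : Nat.Primes, ∑' k : ℕ, c p k * (p : ℝ) ^ (-((k + 1 : ℕ) : ℝ) * y),
    ?_, ?_, ?_⟩
  · intro x hx y _ hxy
    exact logEuler_real_antitone hc' hxy (key x hx).1 (key x hx).2.1
  · intro y _
    exact tsum_nonneg fun p ↦ tsum_nonneg fun k ↦
      mul_nonneg (hc' p k) (Real.rpow_nonneg (Nat.cast_nonneg _) _)
  · intro y hy
    rw [(key y hy).2.2, Complex.ofReal_exp]

end Summit.ABC.ABC.Theorems

end
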